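import Summits.Ventures.HodgeRepro2.T5RecordSatake
import Summits.Ventures.HodgeRepro2.T5InertGlobalPrime

/-!
# The record's spherical Hecke algebra at a place that STAYS PRIME — no standing local hypotheses

Tier-5 support N3 / §G-N4.2 (seat p3, gen 76, cont.). File 232 (`T5RecordSatake`) proves `k[X] ≃ₐ[k] H(U(1 ⊗ H), K_v)`
for the record's own local pair at an inert good place, but carries seat p8's standing local hypotheses: the three
instance hypotheses on `𝒪_{E_v} = integralClosure O_{K⁺_v} K_w` (DVR, finite residue field, fraction ring), the
`v`-adic non-square `θ`, and a uniformiser `ϖ` of `O_{K⁺_v}` that stays irreducible in `O_{K_w}`. This file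
discharges ALL of them from the single GLOBAL hypothesis `hmap : v 𝓞_K = w` (the place `v` of `K⁺` stays prime in
`K`; seat p8's `T5InertGlobalPrime`), so that the record's theorem reads:

* **`heckeAlgebra_mul_comm_record_of_staysPrime`** — at every place of `K⁺` that stays prime in `K` and is good for
  the `3 × 3` hermitian unit-determinant Gram matrix `H`, `H(U(1 ⊗ H), K_v)` is commutative;
* **`nonempty_algEquiv_polynomial_record_of_staysPrime`** — and is `k[X]`;
* `primesOver_eq_singleton_of_staysPrime` / `ncard_primesOver_eq_one_of_staysPrime` / `not_isSquare_of_staysPrime` /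
  `exists_irreducible_and_irreducible_algebraMap_of_staysPrime` — the discharges.

The discharges: the DVR / finite-residue-field instances are seat p8's T5-146 / T5-149
(`isDiscreteValuationRing_integralClosure_adicCompletion`, `finite_residueField_integralClosure_adicCompletion`),
the fraction-ring instance Mathlib's `integralClosure.isFractionRing_of_finite_extension`; the non-square from
`primesOver v = {w}` (`primesOver_eq_singleton_of_staysPrime`, seat p8's `not_isSquare_of_ncard_primesOver_eq_one`);
the uniformiser from Mathlib's DVR instance on `O_{K⁺_v}`
(`IsDiscreteValuationRing.exists_irreducible`), staying irreducible by seat p8's T5-156/T5-157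
`irreducible_algebraMap_of_staysPrime` (`e(w/v) = 1` at a place that stays prime).

§8(d): uses an L-value-free non-vanishing device: NO.
-/

open Matrix NumberField NumberField.IsCMField IsDedekindDomain IsDedekindDomain.HeightOneSpectrum Module
open scoped TensorProduct Pointwise
open Summit.Ventures.HodgeRepro2.T5UnitaryGroupForm Summit.Ventures.HodgeRepro2.T5UnitaryHeckeAdjoint
  Summit.Ventures.HodgeRepro2.T5HeckePermutationModule Summit.Ventures.HodgeRepro2.T5StarOfInvolution
  Summit.Ventures.HodgeRepro2.T5FinitePlaceCM Summit.Ventures.HodgeRepro2.T5FinitePlaceNormIndex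
  Summit.Ventures.HodgeRepro2.T5NonSplitPlaceUnitaryGroup Summit.Ventures.HodgeRepro2.T5RecordHyperspecial
  Summit.Ventures.HodgeRepro2.T5GlobalLatticeAlmostAll Summit.Ventures.HodgeRepro2.T5FinitePlaceSplitClassification
  Summit.Ventures.HodgeRepro2.T5RecordSatake Summit.Ventures.HodgeRepro2.T5InertGlobalPrime
  Summit.Ventures.HodgeRepro2.T5InertPlaceCompletion
  Summit.Ventures.HodgeRepro2.T5InertPlaceCompletionCells

namespace Summit.Ventures.HodgeRepro2.T5RecordSatakeInert

section Record

variable (K : Type*) [Field K] [NumberField K] [IsCMField K]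
variable (v : HeightOneSpectrum (𝓞 (maximalRealSubfield K))) (w : HeightOneSpectrum (𝓞 K))
  [w.asIdeal.LiesOver v.asIdeal]
variable {θ : maximalRealSubfield K} {y : K}
  (hθ : algebraMap (maximalRealSubfield K) K θ = y ^ 2) (hy : complexConj K y ≠ y)
  (hmap : Ideal.map (algebraMap (𝓞 (maximalRealSubfield K)) (𝓞 K)) v.asIdeal = w.asIdeal)
variable {r : ℕ} (l : Fin r → 𝓞 K)

omit [IsCMField K] in
include hmap in
/-- **The primes over a place that stays prime**: if `v 𝓞_K = w`, the set of primes of `𝓞_K` over `v` is `{w}` —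
any prime `P` over `v` contains `v 𝓞_K = w`, and `w` is maximal. -/
theorem primesOver_eq_singleton_of_staysPrime : v.asIdeal.primesOver (𝓞 K) = {w.asIdeal} := by
  ext P
  constructor
  · rintro ⟨hP, hPv⟩
    have hle : w.asIdeal ≤ P := by
      rw [← hmap, Ideal.map_le_iff_le_comap]
      exact le_of_eq hPv.over
    exact (w.isMaximal.eq_of_le hP.ne_top hle).symm
  · rintro rfl
    exact ⟨w.isPrime, inferInstance⟩

omit [IsCMField K] in
include hmap in
/-- The number of primes of `𝓞_K` over a place `v` of `K⁺` that stays prime in `K` is `1`. -/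
theorem ncard_primesOver_eq_one_of_staysPrime : (v.asIdeal.primesOver (𝓞 K)).ncard = 1 := by
  rw [primesOver_eq_singleton_of_staysPrime K v w hmap, Set.ncard_singleton]

include hθ hy hmap in
/-- **Non-square from staying prime**: if `v` stays prime in `K`, then `θ` (with `K = K⁺(√θ)`) is not a square in
`K⁺_v` — seat p8's `not_isSquare_of_ncard_primesOver_eq_one` on `ncard_primesOver_eq_one_of_staysPrime`. -/
theorem not_isSquare_of_staysPrime :
    ¬ IsSquare (algebraMap (maximalRealSubfield K) (v.adicCompletion (maximalRealSubfield K)) θ) :=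
  T5FinitePlaceCMDecomp.not_isSquare_of_ncard_primesOver_eq_one K hθ hy v w
    (ncard_primesOver_eq_one_of_staysPrime K v w hmap)

omit [IsCMField K] in
include hmap in
/-- **A uniformiser that stays one**: if `v` stays prime in `K`, some uniformiser `ϖ` of `O_{K⁺_v}` (Mathlib's DVR
instance) is irreducible in `O_{K_w}` (seat p8's `irreducible_algebraMap_of_staysPrime`). -/
theorem exists_irreducible_and_irreducible_algebraMap_of_staysPrime :
    ∃ ϖ : v.adicCompletionIntegers (maximalRealSubfield K), Irreducible ϖ ∧
      Irreducible (algebraMap (v.adicCompletionIntegers (maximalRealSubfield K)) (w.adicCompletionIntegers K) ϖ) := by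
  obtain ⟨ϖ, hϖ⟩ := IsDiscreteValuationRing.exists_irreducible (v.adicCompletionIntegers (maximalRealSubfield K))
  exact ⟨ϖ, hϖ, irreducible_algebraMap_of_staysPrime v w hmap hϖ⟩

include hθ hy hmap in
/-- **THE RECORD'S SPHERICAL HECKE ALGEBRA IS COMMUTATIVE AT EVERY PLACE THAT STAYS PRIME** (no standing local
hypotheses): for the datum's `3 × 3` hermitian invertible Gram matrix `H` over `K` and a place `v` of `K⁺` that stays
prime in `K` and is good for `H`, `H(U(1 ⊗ H), K_v)` is commutative — file 231's
`heckeAlgebra_mul_comm_record_nonSplit` with its hypotheses discharged. -/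
theorem heckeAlgebra_mul_comm_record_of_staysPrime (k : Type*) [Field k]
    (hl : Submodule.span (𝓞 (maximalRealSubfield K)) (Set.range l) = ⊤)
    {H : Matrix (Fin 3) (Fin 3) K} (hH : H.IsHermitian) (hdet : IsUnit H.det) (hgood : w ∉ badSet H)
    (T S : (letI := tensorStarRing K v; ↥(heckeAlgebra k (recordHyperspecial K v l H)))) :
    T * S = S * T :=
  haveI := isDiscreteValuationRing_integralClosure_adicCompletion v w
  haveI := finite_residueField_integralClosure_adicCompletion v w
  haveI : IsFractionRing (integralClosure (v.adicCompletionIntegers (maximalRealSubfield K)) (w.adicCompletion K))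
      (w.adicCompletion K) :=
    integralClosure.isFractionRing_of_finite_extension (v.adicCompletion (maximalRealSubfield K)) (w.adicCompletion K)
  (exists_irreducible_and_irreducible_algebraMap_of_staysPrime K v w hmap).elim fun _ h =>
    heckeAlgebra_mul_comm_record_nonSplit K v w hθ hy (not_isSquare_of_staysPrime K v w hθ hy hmap) l k hl
      h.1 h.2 hH hdet hgood T S

include hθ hy hmap in
/-- **THE RECORD'S SPHERICAL HECKE ALGEBRA IS `k[X]` AT EVERY PLACE THAT STAYS PRIME** (no standing local
hypotheses): file 232's `nonempty_algEquiv_polynomial_record` with the DVR / finite-residue / fraction-ring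
instances, the `v`-adic non-square and the stable uniformiser all discharged from `hmap : v 𝓞_K = w`. -/
theorem nonempty_algEquiv_polynomial_record_of_staysPrime (k : Type*) [Field k]
    (hl : Submodule.span (𝓞 (maximalRealSubfield K)) (Set.range l) = ⊤)
    {H : Matrix (Fin 3) (Fin 3) K} (hH : H.IsHermitian) (hdet : IsUnit H.det) (hgood : w ∉ badSet H) :
    Nonempty (Polynomial k ≃ₐ[k]
      (letI := tensorStarRing K v; ↥(heckeAlgebra k (recordHyperspecial K v l H)))) := by
  haveI := isDiscreteValuationRing_integralClosure_adicCompletion v w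
  haveI := finite_residueField_integralClosure_adicCompletion v w
  haveI : IsFractionRing (integralClosure (v.adicCompletionIntegers (maximalRealSubfield K)) (w.adicCompletion K))
      (w.adicCompletion K) :=
    integralClosure.isFractionRing_of_finite_extension (v.adicCompletion (maximalRealSubfield K)) (w.adicCompletion K)
  obtain ⟨ϖ, hϖ, hinert⟩ := exists_irreducible_and_irreducible_algebraMap_of_staysPrime K v w hmap
  exact nonempty_algEquiv_polynomial_record K v w hθ hy (not_isSquare_of_staysPrime K v w hθ hy hmap) hϖ hinert l k
    hl hH hdet hgood

end Record

end Summit.Ventures.HodgeRepro2.T5RecordSatakeInert
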